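/-
Copyright (c) 2026 the pub-hodgecm-mathlib formalisation cell (harness21).  Prover seat hodgecm-mathlib-K2E2-p13 (g2),
Track B «K2-LIT» ∕ h413 (stmt-HodgeConjecture-24833), line K2_E2 «ThetaExhaustionByRigidity», unit CAPTURE, file #13R (CLOSER) —
sequel of ★ `Theorems/K2E2CapThetaClassCaptureOriented` (p855041): the socket #13R MODULO THE ONE NAMED ARCHIMEDEAN INPUT «ARCH-ROWS-GEN».
KERNEL module: THEOREMS ONLY (no definition, no named fact, no `sorry`, no instance, no notation).  2026-09-03.
-/
import Summits.HodgeConjecture.HodgeConjecture.Theorems.K2E2CapThetaClassCaptureOriented          -- ★ §1 `capThetaClassCaptureOriented_of : ‹#12R› → ‹#10› → ‹#13R›` (this base, p855041)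
import Summits.HodgeConjecture.HodgeConjecture.Theorems.K2E2CapHolThetaWitnessOrientedOfArchRows  -- ★ `capHolThetaWitnessOriented_of_archRowsGen : ARCH-ROWS-GEN → ‹#12R›` (K2E2-p12, p855353)
import Summits.HodgeConjecture.HodgeConjecture.Theorems.K2E2L2MemOfProjectionRigidity           -- ★ #10 `memOfProjectionRigidity` (K2E2-p10, p854820) BY NAME
import HarnessLib

-- As in the lineage (★ `ThetaLiftFromLineCharacters`, the K2E2 Capture module): statements over the theta-kernel datum elaborate to very large
-- types; elaborate sequentially.
set_option Elab.async false

/-!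
# K2_E2 road (h413 = stmt-HodgeConjecture-24833), unit CAPTURE, file #13R (CLOSER), sequel:
# `sig_K2E2CapThetaClassCaptureOriented` ⟸ ARCH-ROWS-GEN alone

Cell `pub/hodgecm-mathlib` (D-0151), Track B (21-frontier RULING «PUSH BOTH» 2026-09-03, director req624, chair K2-lead, dealer K2E2-plan),
socket module `Summits/HodgeConjecture/HodgeConjecture/Cruxes/H413/Lines/K2_E2_ThetaExhaustionByRigidity_Capture.lean` ED. 4 (7dda032bea4d7a97),
socket **`sig_K2E2CapThetaClassCaptureOriented`** (#13R, CLOSER; = tier-0 `StubThetaClassCaptureR` of `Cruxes/H413/Lines/K2_E2_ThetaExhaustionByRigidity.lean`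
ED. 6).  STATE OF THE UNIT (2026-09-03T22:45Z): #13R is ★-reduced to #12R + #10 (★ §1 `K2E2CapThetaClassCaptureOriented.capThetaClassCaptureOriented_of`,
p855041; #10 ★ p854820), and #12R is ★-reduced (K2E2-p12, p855353 `K2E2CapHolThetaWitnessOriented.capHolThetaWitnessOriented_of_archRowsGen`) to ONE
displayed archimedean text ARCH-ROWS-GEN — at every positively oriented (`ι ∈ Φ_μ`) admissible weight-one TEL frame: Weil majorants, a finite
invariant open-positive Borel measure on `[U(⟨a⟩)]` and an archimedean Schwartz pair `φ` whose theta pairs have (W) the cotangent `K_∞`-type along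
`cmArchSection`, (K) `cmCompactFactor`-invariance, (H) holomorphic germs (every `Φ_f`; the binders of ★ B⁗ `F0P2sThetaPairsCotForms.thetaPair_mem_holCotForms_of_arch`),
with `R^∞_{e₁}φ_{j₀} ≠ 0` and (E) fixed by `U(⟨a⟩)(L⁺ ⊗ ℝ)` under the archimedean Weil representation (the binders of ★ (N5)
`F0P2tThetaPairNeZeroOfFrame.thetaPair_ne_zero_of_archFixed_frame`) — the harmonic Gaussian of the admissible line, [KonnoKonno2007, Thm 5.4] ∕
[Liu2021, App. D Lem. D.2 (2), §D.1 Step 3], which exists exactly at positive orientation.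

* **`capThetaClassCaptureOriented_of_archRowsGen (hA : ‹ARCH-ROWS-GEN, p855353's binder VERBATIM›) : ‹#13R VERBATIM›`** — the composition
  ★ §1 ∘ ★ p855353 ∘ ★ #10, no other input.  USE (tier 0, dealer): with `def StubArchRowsGen : Prop := ‹hA›` (K2E2-p12's cand 3cf401677f2367a6) and
  `theorem stub_archRowsGen : StubArchRowsGen`, the CAPTURE stub reads `stub_thetaClassCaptureR := capThetaClassCaptureOriented_of_archRowsGen stub_archRowsGen`
  — ONE archimedean stub for the whole unit (R12 and CAPR fold onto it).
No hypothesis is idle: `hA` is the only source of a theta function at all (the conclusion `MeetsThetaLiftFromLine` asserts a NON-ZERO theta vector in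
`P.space`); the orientation binder `ι ∈ hμ.cmType.1` of #13R is what makes `hA` satisfiable ([Liu2021, App. D Lem. D.2 (2)]: at `ι ∉ Φ_μ` the theta
pairs are ANTIholomorphic — the R8 finding of K2E2-plan ∕ K2E2-p12, 2026-09-03).

HONEST LABEL: HC_CM is proved only modulo the 7 printed citations (2 remaining named inputs: hLiu418 = stmt-HodgeConjecture-24832,
h413 = stmt-HodgeConjecture-24833) until rung 0 closes; this file is a `--supports stmt-HodgeConjecture-24833` helper: it PAYS NOTHING archimedean —
it only moves the unit's entire open content onto the single named text ARCH-ROWS-GEN (price XL per K2E2-p12's census: in tree only in MODEL currency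
inside the P4 engine ★ `F0P2sThetaOccursInEngineGen.exists_holTheta_atFrame_of_chiN`).

## References
* [Liu2021] Y. Liu, *Fourier–Jacobi cycles and arithmetic relative trace formula*, Camb. J. Math. 9 (2021) = arXiv:2102.11518:
  proof of Prop. 4.13 Case 1 (l. 2129–2137, pp. 47–48) and «Conversely» (l. 2145–2149); App. B §B.2 (l. 4257–4262); App. D §D.1 Step 3, Lem. D.2 (2).
* [KonnoKonno2007] T. Konno, K. Konno, Kyushu J. Math. 61 (2007), Thm. 5.4 p. 75.
* [GelbartRogawski1991] S. Gelbart, J. Rogawski, Invent. Math. 105 (1991): Thm. 5.1.1 p. 465.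
* [DeitmarEchterhoff2014] A. Deitmar, S. Echterhoff, *Principles of Harmonic Analysis*, 2nd ed. (2014): Thm. 9.2.2.  [Dixmier1977] J. Dixmier, *C*-algebras*, 5.4.1.
-/

set_option autoImplicit false
-- the mandated namespace repeats the single-problem summit's segment (`HodgeConjecture.HodgeConjecture`)
set_option linter.dupNamespace false

noncomputable section

namespace Summit.HodgeConjecture.HodgeConjecture.Cruxes.H413.K2E2CapThetaClassCaptureOrientedOfArchRows

open scoped TensorProduct Matrix Kronecker ComplexOrder ENNReal SchwartzMap Classical
open NumberField NumberField.InfinitePlace IsDedekindDomain MeasureTheory MulAction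
open Literature.NumberTheory Literature.NumberTheory.Automorphic Literature.NumberTheory.Automorphic.UnitaryGroup
open Literature.NumberTheory.Automorphic.UnitaryGroup.CotangentForms
open Literature.NumberTheory.Automorphic.Liu2021
open Literature.NumberTheory.Automorphic.Liu2021.Def411WeilCarriers
open Literature.NumberTheory.Automorphic.Liu2021.Def411WeilCarriersDoubling
open Literature.NumberTheory.Automorphic.IdeleClassGroup
open Literature.NumberTheory.GelbartRogawski1991 Literature.NumberTheory.GelbartRogawski1991.UnitaryDualPair
open Literature.NumberTheory.GelbartRogawski1991.UnitaryDualPair.WeilCoinv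
open Literature.NumberTheory.Weil1964
open Literature.RepresentationTheory Literature.RepresentationTheory.Liu2021
open Literature.RepresentationTheory.CompactGroups
open Literature.NumberTheory.Rogawski1990
open Literature.AlgebraicGeometry.ShimuraVarieties (BallForms.isPullbackCocycle_cotangentCocycle)
open Literature.Geometry.ComplexHyperbolic.BallModel (U21 x₀)
open Literature.AlgebraicGeometry.Liu2021 (IsAdmissibleElement)
open Summit.HodgeConjecture.CorCM
open Summit.HodgeConjecture.CorCM.Transposition
open Summit.HodgeConjecture.HodgeConjecture.Cruxes.H413

/-! ## The closer #13R as a function of ARCH-ROWS-GEN alone -/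

set_option synthInstance.maxHeartbeats 400000 in
set_option maxHeartbeats 16000000 in
/-- **Theta-class capture under rigidity at a positively oriented frame, MODULO THE ARCHIMEDEAN ROWS ALONE.**  Hypothesis `hA` = ARCH-ROWS-GEN,
the binder of ★ `K2E2CapHolThetaWitnessOriented.capHolThetaWitnessOriented_of_archRowsGen` TOKEN FOR TOKEN (at every TEL frame with `ι ∈ hμ.cmType.1`,
weight-one `μ`, `a(2δ)⁻¹` `Φ_μ`-admissible, `χ`: Weil majorants, a finite invariant open-positive Borel measure on `[U(⟨a⟩)]`, an archimedean Schwartz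
pair `φ` and `j₀` with the rows (W) ∧ (K) ∧ (H) (every `Φ_f`) ∧ `R^∞_{e₁}φ_{j₀} ≠ 0` ∧ (E) — the harmonic Gaussian of the admissible line
[KonnoKonno2007, Thm 5.4], [Liu2021, App. D Lem. D.2 (2), §D.1 Step 3]); conclusion = `Capture.sig_K2E2CapThetaClassCaptureOriented` (#13R) = tier-0
`StubThetaClassCaptureR`, TOKEN FOR TOKEN.  Proof: ★ p855353 turns `hA` into the statement of #12R (★ (N5) ▸ ★ B⁗ ▸ ★ (β)); ★ §1 p855041 composes it
with ★ #10 `K2E2L2MemOfProjectionRigidity.memOfProjectionRigidity` (rigidity makes every receiver of the pinned theta class equal to `P`; `L²([U(H)])` is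
compact-quotient and discretely decomposable, so projection rigidity captures the non-zero class in `P.space` = `MeetsThetaLiftFromLine`).
[cite: Liu2021, proof of Prop. 4.13 Case 1 (l. 2131–2137, p. 48) and «Conversely» (l. 2145–2149); App. D Lem. D.2 (2), §D.1 Step 3; App. B §B.2 (l. 4257–4262)]
[cite: KonnoKonno2007, Thm. 5.4 p. 75] [cite: GelbartRogawski1991, Thm. 5.1.1 p. 465] [cite: DeitmarEchterhoff2014, Thm. 9.2.2] [cite: Dixmier1977, 5.4.1] -/
theorem capThetaClassCaptureOriented_of_archRowsGen
    (hA :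
      ∀ (L : Type) [Field L] [NumberField L] [IsCMField L] (ι : L →+* ℂ) (H : Matrix (Fin 3) (Fin 3) L) (T : GL (Fin 3) ℂ)
        (hT : (T : Matrix (Fin 3) (Fin 3) ℂ)ᴴ * H.map ι * (T : Matrix (Fin 3) (Fin 3) ℂ) = Literature.Geometry.ComplexHyperbolic.BallModel.J),
        (∀ τ' : L →+* ℂ, InfinitePlace.mk τ' ≠ InfinitePlace.mk ι → (H.map τ').PosDef) → 2 ≤ Module.finrank ℚ ↥(maximalRealSubfield L) →
        ∀ {n' : ℕ} (e₁ : Fin 3 × Fin 1 ≃ Fin n') (dV : Fin 3 → L) (hdV : ∀ i, IsCMField.complexConj L (dV i) = dV i)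
          (hdV0 : ∀ i, dV i ≠ 0) (g : GL (Fin 3) L)
          (hg : ((g : Matrix (Fin 3) (Fin 3) L).map (cmConjRingHom L))ᵀ * H * (g : Matrix (Fin 3) (Fin 3) L) = Matrix.diagonal dV)
          (ιV : finAdelic (↥(maximalRealSubfield L)) L (IsCMField.complexConj L) 3 H →*
              finAdelic (↥(maximalRealSubfield L)) L (IsCMField.complexConj L) 3 (Matrix.diagonal dV)),
            (∀ k, ((ιV k : finAdelic (↥(maximalRealSubfield L)) L (IsCMField.complexConj L) 3 (Matrix.diagonal dV)) :
                GL (Fin 3) (FiniteAdeleRing (𝓞 L) L)) =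
              (toFinAdeleGL L 3 g)⁻¹ * (k : GL (Fin 3) (FiniteAdeleRing (𝓞 L) L)) * toFinAdeleGL L 3 g) →
          ∀ [CompactSpace (↥(UnitaryGroup.adelic (↥(maximalRealSubfield L)) L (IsCMField.complexConj L) 3 (Matrix.diagonal dV)) ⧸
              (UnitaryGroup.toAdelic (↥(maximalRealSubfield L)) L (IsCMField.complexConj L) 3 (Matrix.diagonal dV)).range)],
          ∀ (μ : Literature.NumberTheory.Automorphic.IdeleClassGroup L →ₜ* Circle) (hμ : IsConjugateSymplectic L μ), HasWeight L μ 1 →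
            ι ∈ hμ.cmType.1 →
          ∀ (a : (↥(maximalRealSubfield L))ˣ) (χ : Chi (↥(maximalRealSubfield L)) L (IsCMField.complexConj L)),
              IsAdmissibleElement L hμ.cmType.1 (algebraMap (↥(maximalRealSubfield L)) L a * (2 * imagUnit L)⁻¹) →
              letI : MeasurableSpace (↥(UnitaryGroup.adelic (↥(maximalRealSubfield L)) L (IsCMField.complexConj L) 1
                  (JW (↥(maximalRealSubfield L)) L a)) ⧸
                    (UnitaryGroup.toAdelic (↥(maximalRealSubfield L)) L (IsCMField.complexConj L) 1 (JW (↥(maximalRealSubfield L)) L a)).range) :=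
                borel _
              ∃ (hρ : HasThetaMajorants fun
                  (p : ↥(UnitaryGroup.adelic (↥(maximalRealSubfield L)) L (IsCMField.complexConj L) 3 (Matrix.diagonal dV)) ×
                    ↥(UnitaryGroup.adelic (↥(maximalRealSubfield L)) L (IsCMField.complexConj L) 1 (JW (↥(maximalRealSubfield L)) L a)))
                  (Φ : piSchwartzBruhat (↥(maximalRealSubfield L)) (Fin n')) =>
                    pairRep (↥(maximalRealSubfield L)) L (IsCMField.complexConj L) 3 1 e₁ (Matrix.diagonal dV) (JW (↥(maximalRealSubfield L)) L a)
                      (chiSplittingLine L e₁ dV hdV hdV0 (toHeckeCharacter L μ) (isUnitary_toHeckeCharacter L μ)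
                        ((isOscillatorChar_toHeckeCharacter_iff μ).mpr hμ) (TW (↥(maximalRealSubfield L)) a)
                        (isUnit_det_TW (↥(maximalRealSubfield L)) a) (JW (↥(maximalRealSubfield L)) L a) (JW_eq (↥(maximalRealSubfield L)) L a))
                      p Φ)
                (μW : Measure (↥(UnitaryGroup.adelic (↥(maximalRealSubfield L)) L (IsCMField.complexConj L) 1
                  (JW (↥(maximalRealSubfield L)) L a)) ⧸
                    (UnitaryGroup.toAdelic (↥(maximalRealSubfield L)) L (IsCMField.complexConj L) 1 (JW (↥(maximalRealSubfield L)) L a)).range))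
                (_ : IsFiniteMeasure μW)
                (_ : SMulInvariantMeasure
                  (↥(UnitaryGroup.adelic (↥(maximalRealSubfield L)) L (IsCMField.complexConj L) 1 (JW (↥(maximalRealSubfield L)) L a)))
                  (↥(UnitaryGroup.adelic (↥(maximalRealSubfield L)) L (IsCMField.complexConj L) 1 (JW (↥(maximalRealSubfield L)) L a)) ⧸
                    (UnitaryGroup.toAdelic (↥(maximalRealSubfield L)) L (IsCMField.complexConj L) 1 (JW (↥(maximalRealSubfield L)) L a)).range)
                  μW)
                (_ : μW.IsOpenPosMeasure)
                (φ : Fin 2 → 𝓢(((Fin 3 × Fin 1) → NumberField.mixedEmbedding.mixedSpace ↥(maximalRealSubfield L)), ℂ)) (j₀ : Fin 2),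
                -- the rows (W) ∧ (K) ∧ (H) ∧ (R^∞φ_{j₀} ≠ 0) ∧ (E):
                -- (W) the cotangent `K_∞`-type along `cmArchSection`
                (haveI := normal_range_toAdelic_JW L a
                 ∀ (Φf : FinSB (↥(maximalRealSubfield L)) (Fin 3 × Fin 1)) (k : ↥(stabilizer (↥U21) x₀))
                    (x : (adelicGroupData (↥(maximalRealSubfield L)) L (IsCMField.complexConj L) 3 H).Adelic),
                    (fun (j : Fin 2) =>
                      (lineThetaKernelDatum L 3 e₁ dV hdV hdV0 μ hμ a hρ).thetaLiftFun μW
                        (piSBReindex (↥(maximalRealSubfield L)) e₁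
                          (piSchwartzBruhatEquiv (↥(maximalRealSubfield L)) (Fin 3 × Fin 1) (φ j ⊗ₜ[ℂ] Φf)))
                        (charCM (chiQuot (↥(maximalRealSubfield L)) L (IsCMField.complexConj L) (Algebra.IsQuadraticExtension.finrank_eq_two _ L)
                          (IsCMField.complexConj_ne_one (K := L)) a χ))
                        ((cmAdelicFrameTransport L 3 H dV g hg) (x * ((cmArchSection L ι H T hT).comp (stabilizer (↥U21) x₀).subtype) k))) =
                      (BallForms.isPullbackCocycle_cotangentCocycle.weightOf x₀) k⁻¹ ((fun (j : Fin 2) =>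
                      (lineThetaKernelDatum L 3 e₁ dV hdV hdV0 μ hμ a hρ).thetaLiftFun μW
                        (piSBReindex (↥(maximalRealSubfield L)) e₁
                          (piSchwartzBruhatEquiv (↥(maximalRealSubfield L)) (Fin 3 × Fin 1) (φ j ⊗ₜ[ℂ] Φf)))
                        (charCM (chiQuot (↥(maximalRealSubfield L)) L (IsCMField.complexConj L) (Algebra.IsQuadraticExtension.finrank_eq_two _ L)
                          (IsCMField.complexConj_ne_one (K := L)) a χ))
                        ((cmAdelicFrameTransport L 3 H dV g hg) x)))) ∧
                -- (K) invariance under the compact archimedean factor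
                (haveI := normal_range_toAdelic_JW L a
                 ∀ (Φf : FinSB (↥(maximalRealSubfield L)) (Fin 3 × Fin 1)), ∀ k ∈ cmCompactFactor L ι H T hT,
                    ∀ (x : (adelicGroupData (↥(maximalRealSubfield L)) L (IsCMField.complexConj L) 3 H).Adelic),
                    (fun (j : Fin 2) =>
                      (lineThetaKernelDatum L 3 e₁ dV hdV hdV0 μ hμ a hρ).thetaLiftFun μW
                        (piSBReindex (↥(maximalRealSubfield L)) e₁
                          (piSchwartzBruhatEquiv (↥(maximalRealSubfield L)) (Fin 3 × Fin 1) (φ j ⊗ₜ[ℂ] Φf)))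
                        (charCM (chiQuot (↥(maximalRealSubfield L)) L (IsCMField.complexConj L) (Algebra.IsQuadraticExtension.finrank_eq_two _ L)
                          (IsCMField.complexConj_ne_one (K := L)) a χ))
                        ((cmAdelicFrameTransport L 3 H dV g hg) (x * k))) = (fun (j : Fin 2) =>
                      (lineThetaKernelDatum L 3 e₁ dV hdV hdV0 μ hμ a hρ).thetaLiftFun μW
                        (piSBReindex (↥(maximalRealSubfield L)) e₁
                          (piSchwartzBruhatEquiv (↥(maximalRealSubfield L)) (Fin 3 × Fin 1) (φ j ⊗ₜ[ℂ] Φf)))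
                        (charCM (chiQuot (↥(maximalRealSubfield L)) L (IsCMField.complexConj L) (Algebra.IsQuadraticExtension.finrank_eq_two _ L)
                          (IsCMField.complexConj_ne_one (K := L)) a χ))
                        ((cmAdelicFrameTransport L 3 H dV g hg) x))) ∧
                -- (H) holomorphic germs along `cmArchSection`
                (haveI := normal_range_toAdelic_JW L a
                 ∀ (Φf : FinSB (↥(maximalRealSubfield L)) (Fin 3 × Fin 1)),
                    IsHolGerm (cmArchSection L ι H T hT) ((fun (x : (adelicGroupData (↥(maximalRealSubfield L)) L (IsCMField.complexConj L) 3 H).Adelic) (j : Fin 2) =>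
                      (lineThetaKernelDatum L 3 e₁ dV hdV hdV0 μ hμ a hρ).thetaLiftFun μW
                        (piSBReindex (↥(maximalRealSubfield L)) e₁
                          (piSchwartzBruhatEquiv (↥(maximalRealSubfield L)) (Fin 3 × Fin 1) (φ j ⊗ₜ[ℂ] Φf)))
                        (charCM (chiQuot (↥(maximalRealSubfield L)) L (IsCMField.complexConj L) (Algebra.IsQuadraticExtension.finrank_eq_two _ L)
                          (IsCMField.complexConj_ne_one (K := L)) a χ))
                        ((cmAdelicFrameTransport L 3 H dV g hg) x)))) ∧
                -- the archimedean vector `R^∞_{e₁} φ_{j₀}` is non-zero …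
                schwartzReindexCLM (↥(maximalRealSubfield L)) e₁ (φ j₀) ≠ 0 ∧
                -- (E) … and FIXED by `U(⟨a⟩)(L⁺ ⊗ ℝ)` under the archimedean Weil representation at the `μ`-splitting
                (∀ a' : UnitaryGroup.arch (↥(maximalRealSubfield L)) L (IsCMField.complexConj L) 1 (JW (↥(maximalRealSubfield L)) L a),
                  HodgeCM.Model.HypCensus.archWeilRep (↥(maximalRealSubfield L)) L (IsCMField.complexConj L) 3 1 (Matrix.diagonal dV)
                    (JW (↥(maximalRealSubfield L)) L a) (complexConj_imagUnit L) (imagUnit_ne_zero L) (imagUnit_mul_self L) (realDiagonal_isSymm L dV hdV)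
                    (isSymm_TW (↥(maximalRealSubfield L)) a) (isUnit_det_realDiagonal L dV hdV hdV0) (isUnit_det_TW (↥(maximalRealSubfield L)) a)
                    (realDiagonal_map L dV hdV).symm (JW_eq (↥(maximalRealSubfield L)) L a) e₁
                    (chiSplittingLine L e₁ dV hdV hdV0 (toHeckeCharacter L μ) (isUnitary_toHeckeCharacter L μ)
                      ((isOscillatorChar_toHeckeCharacter_iff μ).mpr hμ) (TW (↥(maximalRealSubfield L)) a)
                      (isUnit_det_TW (↥(maximalRealSubfield L)) a) (JW (↥(maximalRealSubfield L)) L a) (JW_eq (↥(maximalRealSubfield L)) L a))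
                    (ThetaNonvanishing.proj_apply_eq_toSp (↥(maximalRealSubfield L)) L (IsCMField.complexConj L) 3 1 e₁ (Matrix.diagonal dV)
                      (JW (↥(maximalRealSubfield L)) L a) (complexConj_imagUnit L) (imagUnit_ne_zero L) (imagUnit_mul_self L) (realDiagonal_isSymm L dV hdV)
                      (isSymm_TW (↥(maximalRealSubfield L)) a) (isUnit_det_realDiagonal L dV hdV hdV0) (isUnit_det_TW (↥(maximalRealSubfield L)) a)
                      (realDiagonal_map L dV hdV).symm (JW_eq (↥(maximalRealSubfield L)) L a)
                      (isCompatible_chiSplittingLine L e₁ dV hdV hdV0 (toHeckeCharacter L μ) (isUnitary_toHeckeCharacter L μ)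
                        ((isOscillatorChar_toHeckeCharacter_iff μ).mpr hμ) (TW (↥(maximalRealSubfield L)) a) (isSymm_TW (↥(maximalRealSubfield L)) a)
                        (isUnit_det_TW (↥(maximalRealSubfield L)) a) (JW (↥(maximalRealSubfield L)) L a) (JW_eq (↥(maximalRealSubfield L)) L a)))
                    (1, a') (schwartzReindexCLM (↥(maximalRealSubfield L)) e₁ (φ j₀)) = schwartzReindexCLM (↥(maximalRealSubfield L)) e₁ (φ j₀))) :
    ∀ (L : Type) [Field L] [NumberField L] [IsCMField L] (ι : L →+* ℂ) (H : Matrix (Fin 3) (Fin 3) L) (T : GL (Fin 3) ℂ)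
      (hT : (T : Matrix (Fin 3) (Fin 3) ℂ)ᴴ * H.map ι * (T : Matrix (Fin 3) (Fin 3) ℂ) = Literature.Geometry.ComplexHyperbolic.BallModel.J),
      (∀ τ' : L →+* ℂ, InfinitePlace.mk τ' ≠ InfinitePlace.mk ι → (H.map τ').PosDef) → 2 ≤ Module.finrank ℚ ↥(maximalRealSubfield L) →
      ∀ {n' : ℕ} (e₁ : Fin 3 × Fin 1 ≃ Fin n') (dV : Fin 3 → L) (hdV : ∀ i, IsCMField.complexConj L (dV i) = dV i)
        (hdV0 : ∀ i, dV i ≠ 0) (g : GL (Fin 3) L)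
        (hg : ((g : Matrix (Fin 3) (Fin 3) L).map (cmConjRingHom L))ᵀ * H * (g : Matrix (Fin 3) (Fin 3) L) = Matrix.diagonal dV)
        (ιA : (adelicGroupData (↥(maximalRealSubfield L)) L (IsCMField.complexConj L) 3 H).Adelic →*
            ↥(UnitaryGroup.adelic (↥(maximalRealSubfield L)) L (IsCMField.complexConj L) 3 (Matrix.diagonal dV))),
          (∀ k, ((ιA k : ↥(UnitaryGroup.adelic (↥(maximalRealSubfield L)) L (IsCMField.complexConj L) 3 (Matrix.diagonal dV))) :
                GL (Fin 3) (AdeleRing (𝓞 L) L)) =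
              (toAdeleGL L g)⁻¹ * adelicVal (↥(maximalRealSubfield L)) L (IsCMField.complexConj L) 3 H k * toAdeleGL L g) →
        ∀ (ιV : finAdelic (↥(maximalRealSubfield L)) L (IsCMField.complexConj L) 3 H →*
            finAdelic (↥(maximalRealSubfield L)) L (IsCMField.complexConj L) 3 (Matrix.diagonal dV)),
          (∀ k, ((ιV k : finAdelic (↥(maximalRealSubfield L)) L (IsCMField.complexConj L) 3 (Matrix.diagonal dV)) :
              GL (Fin 3) (FiniteAdeleRing (𝓞 L) L)) =
            (toFinAdeleGL L 3 g)⁻¹ * (k : GL (Fin 3) (FiniteAdeleRing (𝓞 L) L)) * toFinAdeleGL L 3 g) →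
        ∀ [CompactSpace (↥(UnitaryGroup.adelic (↥(maximalRealSubfield L)) L (IsCMField.complexConj L) 3 (Matrix.diagonal dV)) ⧸
            (UnitaryGroup.toAdelic (↥(maximalRealSubfield L)) L (IsCMField.complexConj L) 3 (Matrix.diagonal dV)).range)],
        ∀ (μA : Measure (adelicGroupData (↥(maximalRealSubfield L)) L (IsCMField.complexConj L) 3 H).automorphicQuotient)
          [(adelicGroupData (↥(maximalRealSubfield L)) L (IsCMField.complexConj L) 3 H).IsAutomorphicMeasure μA]
          (P : DiscreteAutomorphicRep (adelicGroupData (↥(maximalRealSubfield L)) L (IsCMField.complexConj L) 3 H) μA),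
          P.IsHolCotangentAt (cmArchSection L ι H T hT) (cmCompactFactor L ι H T hT) →
          ∀ (μ : Literature.NumberTheory.Automorphic.IdeleClassGroup L →ₜ* Circle) (hμ : IsConjugateSymplectic L μ), HasWeight L μ 1 →
            ι ∈ hμ.cmType.1 →
            ∀ (a : (↥(maximalRealSubfield L))ˣ) (χ : Chi (↥(maximalRealSubfield L)) L (IsCMField.complexConj L)),
              IsAdmissibleElement L hμ.cmType.1 (algebraMap (↥(maximalRealSubfield L)) L a * (2 * imagUnit L)⁻¹) →
              P.HasFinComponent
                (rhoAtLine (↥(maximalRealSubfield L)) L (IsCMField.complexConj L) 3 e₁ (Matrix.diagonal dV)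
                  (complexConj_imagUnit L) (imagUnit_ne_zero L) (imagUnit_mul_self L) (realDiagonal_isSymm L dV hdV)
                  (isUnit_det_realDiagonal L dV hdV hdV0) (realDiagonal_map L dV hdV).symm
                  (fun a => isCompatible_chiSplittingLine L e₁ dV hdV hdV0 (toHeckeCharacter L μ)
                    (isUnitary_toHeckeCharacter L μ) ((isOscillatorChar_toHeckeCharacter_iff μ).mpr hμ)
                    (TW (↥(maximalRealSubfield L)) a) (isSymm_TW (↥(maximalRealSubfield L)) a)
                    (isUnit_det_TW (↥(maximalRealSubfield L)) a) (JW (↥(maximalRealSubfield L)) L a)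
                    (JW_eq (↥(maximalRealSubfield L)) L a)) ιV a χ) →
              (∀ P' : DiscreteAutomorphicRep (adelicGroupData (↥(maximalRealSubfield L)) L (IsCMField.complexConj L) 3 H) μA,
                  P'.IsHolCotangentAt (cmArchSection L ι H T hT) (cmCompactFactor L ι H T hT) →
                  P'.HasFinComponent
                    (rhoAtLine (↥(maximalRealSubfield L)) L (IsCMField.complexConj L) 3 e₁ (Matrix.diagonal dV)
                      (complexConj_imagUnit L) (imagUnit_ne_zero L) (imagUnit_mul_self L) (realDiagonal_isSymm L dV hdV)
                      (isUnit_det_realDiagonal L dV hdV hdV0) (realDiagonal_map L dV hdV).symm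
                      (fun a => isCompatible_chiSplittingLine L e₁ dV hdV hdV0 (toHeckeCharacter L μ)
                        (isUnitary_toHeckeCharacter L μ) ((isOscillatorChar_toHeckeCharacter_iff μ).mpr hμ)
                        (TW (↥(maximalRealSubfield L)) a) (isSymm_TW (↥(maximalRealSubfield L)) a)
                        (isUnit_det_TW (↥(maximalRealSubfield L)) a) (JW (↥(maximalRealSubfield L)) L a)
                        (JW_eq (↥(maximalRealSubfield L)) L a)) ιV a χ) →
                  P' = P) →
              MeetsThetaLiftFromLine L 3 H e₁ dV hdV hdV0 P μ hμ a ιA :=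
  K2E2CapThetaClassCaptureOriented.capThetaClassCaptureOriented_of
    (K2E2CapHolThetaWitnessOriented.capHolThetaWitnessOriented_of_archRowsGen hA)
    @K2E2L2MemOfProjectionRigidity.memOfProjectionRigidity

end Summit.HodgeConjecture.HodgeConjecture.Cruxes.H413.K2E2CapThetaClassCaptureOrientedOfArchRows

end
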